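import Literature.Computability.MetaComplexity.EFModAddDom
import HarnessLib

/-!
# Modular addition in extended Frege: the split identity `s = u + [s ≥ n]·n`

Layer D/3 of the `EF`-proof construction kit. For an occurrence of `ModAdd.addModT` (sum
`s = x + y` on `W+1` bits, selector `G = [s ≥ n]`, result `u`) with `x < n` and `y < n` certified,
the sum splits, provably inside Frege, as `s = u + G·n`: for the `(W+1)`-bit adder
`P = zext(u) + zext(G ∧ n)` (the *split adder* of the auxiliary template `ModAdd.splitAuxT`, whose
second operand is the mask row `Gᵢ ∧ nᵢ`), the sum bits of `P` are provably those of `s` and `P`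
does not overflow (`ModAdd.splitSum`). This is the form in which the four modular additions of the
associativity law are turned into one identity between ordinary sums.

The argument is a case analysis on `G` as in `EFModAddDom.lean`, whose case-free preparations it
reuses: if `G`, the difference `d = s - n` has a vanishing top bit (`d < x`, `ModAdd.DomAux.caseSelTop`),
so `zext(u) = d` and `P` is, wire by wire, the adder `d + n = s`; if `¬G`, the mask vanishes, `P`
adds zero, and `zext(u) = s` because the top bit of `s` vanishes.

## Sources

* S. A. Cook, R. A. Reckhow, *The relative efficiency of propositional proof systems*,
  J. Symbolic Logic 44 (1979), §2 (sound schematic rules).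
* J. Krajíček, *Bounded Arithmetic, Propositional Logic, and Complexity Theory* (CUP 1995), §9.2.
-/

namespace Literature.Computability.MetaComplexity

open _root_.Computability Complexity Complexity.PropForm FregeSystem Netlist

namespace ModAdd

/-! ### The auxiliary template of the split identity

Inputs (`2W + 2`): the result `u` (`0…W-1`), `n` (`W…2W-1`), the selector `G` (`2W`) and the
`⊥` gate (`2W+1`) of the occurrence. -/

namespace SplitAux

/-- The mask row `Gᵢ' = G ∧ nᵢ`. [cite: Vollmer1999, §1.1] -/
def maskRow (W : ℕ) : Template := (List.range W).map fun i => ⟨Kind.and, [Sum.inl (2 * W), Sum.inl (W + i)]⟩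

/-- Length of the mask row. [folklore] -/
@[simp] theorem length_maskRow (W : ℕ) : (maskRow W).length = W := by simp [maskRow]

/-- Gates of the mask row. [folklore] -/
theorem getElem_maskRow (W : ℕ) {i : ℕ} (h : i < (maskRow W).length) :
    (maskRow W)[i] = ⟨Kind.and, [Sum.inl (2 * W), Sum.inl (W + i)]⟩ := by
  simp [maskRow]

/-- The mask row is well formed. [cite: Vollmer1999, Def. 1.6] -/
theorem wf_maskRow (W : ℕ) : (maskRow W).WF (2 * W + 2) := by
  intro k hk
  rw [getElem_maskRow]
  have hk' : k < W := by simpa using hk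
  refine ⟨rfl, fun a ha => ?_⟩
  simp only [List.mem_cons, List.not_mem_nil, or_false] at ha
  rcases ha with rfl | rfl
  · exact ⟨fun i hi => by cases hi; omega, fun j hj => by cases hj⟩
  · exact ⟨fun i hi => by cases hi; omega, fun j hj => by cases hj⟩

/-- Wiring of the split adder `zext(u) + zext(mask)` (`W+1` bits). [folklore] -/
def wP (W i : ℕ) : ℕ ⊕ ℕ :=
  if i < W then Sum.inl i else if i = W then Sum.inl (2 * W + 1)
  else if i < 2 * W + 1 then Sum.inr (i - (W + 1)) else Sum.inl (2 * W + 1)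

/-- The split adder reads `u`. [folklore] -/
theorem wP_u (W : ℕ) {i : ℕ} (hi : i < W) : wP W i = Sum.inl i := by simp [wP, hi]

/-- The split adder reads the `⊥` gate as top bit of the first operand. [folklore] -/
theorem wP_f₁ (W : ℕ) : wP W W = Sum.inl (2 * W + 1) := by simp [wP]

/-- The split adder reads the masks. [folklore] -/
theorem wP_m (W : ℕ) {i : ℕ} (hi : i < W) : wP W (W + 1 + i) = Sum.inr i := by
  unfold wP
  rw [if_neg (by omega), if_neg (by omega), if_pos (by omega)]
  congr 1
  omega

/-- The split adder reads the `⊥` gate as top bit of the second operand. [folklore] -/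
theorem wP_f₂ (W : ℕ) : wP W (W + 1 + W) = Sum.inl (2 * W + 1) := by
  unfold wP
  rw [if_neg (by omega), if_neg (by omega), if_neg (by omega)]

/-- The two pieces: the mask row and the split adder. [cite: Vollmer1999, §1.2] -/
def pieces (W : ℕ) : ℕ → Piece
  | 0 => ⟨maskRow W, 2 * W + 2, Sum.inl⟩
  | _ => ⟨Adder.addT false (W + 1), 2 * (W + 1), wP W⟩

/-- Offsets. [folklore] -/
theorem offsets (W : ℕ) : offset (pieces W) 1 = W ∧ offset (pieces W) 2 = 3 * W + 3 := by
  have h1 : offset (pieces W) 1 = W := by rw [offset_succ, offset_zero]; simp [pieces]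
  have h2 : offset (pieces W) 2 = 3 * W + 3 := by rw [offset_succ, h1]; simp [pieces]; ring
  exact ⟨h1, h2⟩

/-- The pieces are well formed and well wired. [cite: Vollmer1999, Def. 1.6] -/
theorem piece_ok (W : ℕ) : ∀ k < 2, Piece.OK (pieces W) (2 * W + 2) k := by
  obtain ⟨h1, -⟩ := offsets W
  intro k hk
  have hk' : k = 0 ∨ k = 1 := by omega
  rcases hk' with rfl | rfl
  · refine ⟨wf_maskRow W, fun i hi => ⟨fun a ha => ?_, fun g hg => ?_⟩⟩
    · simp only [pieces, Sum.inl.injEq] at ha hi; omega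
    · simp [pieces] at hg
  · refine ⟨Adder.wf_addT false (W + 1), fun i hi => ?_⟩
    simp only [pieces] at hi ⊢
    rw [h1]
    by_cases hiW : i < W
    · rw [wP_u W hiW]; exact ⟨fun a ha => (by cases ha; omega), fun g hg => by cases hg⟩
    by_cases hiW' : i = W
    · rw [hiW', wP_f₁]; exact ⟨fun a ha => (by cases ha; omega), fun g hg => by cases hg⟩
    by_cases hi2 : i < W + 1 + W
    · obtain ⟨j, rfl⟩ : ∃ j, i = W + 1 + j := ⟨i - (W + 1), by omega⟩
      rw [wP_m W (by omega)]; exact ⟨fun a ha => (by cases ha), fun g hg => by cases hg; omega⟩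
    · rw [show i = W + 1 + W by omega, wP_f₂]; exact ⟨fun a ha => (by cases ha; omega), fun g hg => by cases hg⟩

end SplitAux

/-- **The auxiliary template of the split identity**: the masks `G ∧ nᵢ` and the split adder
`zext(u) + zext(G ∧ n)`. [cite: Vollmer1999, §1.2] -/
def splitAuxT (W : ℕ) : Template := layout (SplitAux.pieces W) 2

/-- The auxiliary template is well formed (`2W + 2` inputs). [cite: Vollmer1999, Def. 1.6] -/
theorem wf_splitAuxT (W : ℕ) : (splitAuxT W).WF (2 * W + 2) := wf_layout (SplitAux.pieces W) (SplitAux.piece_ok W)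

/-- Size of the auxiliary template: `3W + 3` gates. [folklore] -/
@[simp] theorem length_splitAuxT (W : ℕ) : (splitAuxT W).length = 3 * W + 3 := by
  rw [splitAuxT, length_layout]; exact (SplitAux.offsets W).2

/-! ### Views of the split occurrence -/

namespace SplitAux

variable (W : ℕ) (o b : Occ)

/-- The mask gates `Gᵢ' = G ∧ nᵢ`. [folklore] -/
def M : ℕ → ℕ := fun i => b.base + i

/-- The split adder `zext(u) + zext(mask)` on `W+1` bits. [folklore] -/
def P : Adder.View := ⟨b.base + W, Adder.zext (u W o) (f W o) W, Adder.zext (M b) (f W o) W⟩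

/-- `SWired W o b`: the split occurrence reads the result, `n`, the selector and the `⊥` gate of `o`.
[folklore] -/
structure SWired : Prop where
  /-- the result -/
  hu : ∀ i < W, b.inp i = u W o i
  /-- `n` -/
  hn : ∀ i < W, b.inp (W + i) = nv W o i
  /-- the selector -/
  hsel : b.inp (2 * W) = sel W o
  /-- the `⊥` gate -/
  hf : b.inp (2 * W + 1) = f W o

/-- `SplitViews W o b K Γ`: the mask definitions and the split adder are available. [folklore] -/
structure SplitViews (K : PropForm ℕ) (Γ : Set (PropForm ℕ)) : Prop where
  /-- the masks -/
  mask : ∀ i < W, ctx K (biimp (var (M b i)) (conj (var (sel W o)) (var (nv W o i)))) ∈ Γ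
  /-- the split adder -/
  adder : (P W o b).Avail K Γ false (W + 1)

variable {W o b}

/-- Availability of the split views is monotone. [folklore] -/
theorem SplitViews.mono {K : PropForm ℕ} {Γ Γ' : Set (PropForm ℕ)} (h : SplitViews W o b K Γ) (hΓ : Γ ⊆ Γ') :
    SplitViews W o b K Γ' :=
  ⟨fun i hi => hΓ (h.mask i hi), h.adder.mono hΓ⟩

/-- **An available, correctly wired split occurrence provides the split views.** [folklore] -/
theorem splitAvail {K : PropForm ℕ} {Γ : Set (PropForm ℕ)} (hb : b.Avail (splitAuxT W) (2 * W + 2) K Γ) (hw : SWired W o b) :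
    SplitViews W o b K Γ := by
  obtain ⟨h1, -⟩ := offsets W
  have hI : (b.inst (2 * W + 2)).DefsAvail (layout (pieces W) 2) K Γ := hb
  have href : ∀ i < 2 * W + 2, (b.inst (2 * W + 2)).ref (Sum.inl i) = b.inp i := fun i hi => b.ref_inl hi
  refine ⟨fun i hi => ?_, ?_⟩
  · obtain ⟨hk, heq⟩ := getElem_layout (pieces W) (k := 0) (N := 2) (j := i) (by omega) (by simpa [pieces] using hi)
    have h := hI (offset (pieces W) 0 + i) hk
    rw [heq] at h
    rw [offset_zero, Nat.zero_add] at h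
    have hg : (pieces W 0).T[i]'(by simpa [pieces] using hi) = ⟨Kind.and, [Sum.inl (2 * W), Sum.inl (W + i)]⟩ := getElem_maskRow W _
    rw [hg] at h
    have e : (b.inst (2 * W + 2)).body ⟨Kind.and, [Sum.inl (2 * W), Sum.inl (W + i)].map (remap (pieces W 0).wire 0)⟩ =
        conj (var (sel W o)) (var (nv W o i)) := by
      show conj (var ((b.inst (2 * W + 2)).ref (remap Sum.inl 0 (Sum.inl (2 * W)))))
        (var ((b.inst (2 * W + 2)).ref (remap Sum.inl 0 (Sum.inl (W + i))))) = _
      simp only [remap]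
      rw [href _ (by omega), href _ (by omega), hw.hsel, hw.hn i hi]
    rw [e] at h
    exact h
  · have h := Adder.avail_viewEmb (c₀ := false) (W := W + 1) (off := offset (pieces W) 1) (w := wP W) hI fun k hk =>
      getElem_layout (pieces W) (k := 1) (N := 2) (by omega) hk
    rw [h1] at h
    refine h.congr rfl (fun i hi => ?_) fun i hi => ?_
    · show Adder.zext (u W o) (f W o) W i = (b.inst (2 * W + 2)).ref (wP W i)
      rcases Nat.lt_succ_iff_lt_or_eq.1 hi with hi' | hi'
      · rw [Adder.zext_lt _ _ hi', wP_u W hi', href i (by omega), hw.hu i hi']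
      · rw [hi', Adder.zext_top, wP_f₁, href _ (by omega), hw.hf]
    · show Adder.zext (M b) (f W o) W i = (b.inst (2 * W + 2)).ref (wP W (W + 1 + i))
      rcases Nat.lt_succ_iff_lt_or_eq.1 hi with hi' | hi'
      · rw [Adder.zext_lt _ _ hi', wP_m W hi']; rfl
      · rw [hi', Adder.zext_top, wP_f₂, href _ (by omega), hw.hf]

/-- The lines of the split identity: `sᵢ(P) ↔ sᵢ` (`i ≤ W`, the last being the carry-out of `s`)
and `¬c_{W+1}(P)`. [folklore] -/
def splitBodies (W : ℕ) (o b : Occ) : List (PropForm ℕ) :=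
  eqW (P W o b).s (Adder.extOut (A W o) W) (W + 1) ++ [neg (var ((P W o b).c (W + 1)))]

/-- Length of the split lines. [folklore] -/
@[simp] theorem length_splitBodies (W : ℕ) (o b : Occ) : (splitBodies W o b).length = W + 2 := by simp [splitBodies, eqW]

/-- Sizes of the split lines. [folklore] -/
theorem size_of_mem_splitBodies {W : ℕ} {o b : Occ} {L : PropForm ℕ} (h : L ∈ splitBodies W o b) : L.size ≤ 9 := by
  rcases List.mem_append.1 h with h | h
  · obtain ⟨i, -, rfl⟩ := List.mem_map.1 h; simp [size_eqv]
  · rw [List.mem_singleton.1 h]; simp [size]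

end SplitAux

/-! ### The case `G`: the top bit of the difference vanishes -/

namespace DomAux

variable {G : FregeSystem} {K : PropForm ℕ} {Γ : Set (PropForm ℕ)} {W : ℕ} {o a : Occ}

/-- **Case `G`: `d + n` does not overflow and the top bit of `d = s - n` is false** (`d < x`).
Under any context in which the auxiliary views, the selector, `c_{W+1}(E) ↔ ¬G`, `¬ge_{W+1}(T2)`,
`¬c_{W+1}(XN)` and the literal of the auxiliary `⊥` gate are available. [cite: CookReckhow1979, §2] -/
theorem caseSelTop (hG : RulesOK G) (av : AuxViews W o a K Γ) (hsel : ctx K (var (sel W o)) ∈ Γ)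
    (hEc : ctx K (biimp (var ((E W o a).c (W + 1))) (neg (var (sel W o)))) ∈ Γ)
    (hT2 : ctx K (neg (var ((T2 W o a).ge (W + 2) (W + 1)))) ∈ Γ)
    (hXNc : ctx K (neg (var ((XN W o a).c (W + 1)))) ∈ Γ) (hfa : ctx K (neg (var (fa a))) ∈ Γ) :
    G.Yields Γ ({ctx K (neg (var ((E W o a).c (W + 1))))} ∪ {ctx K (neg (var (d W o W)))}) ((W + 9) * (K.size + 55)) := by
  have g2 := negOfEqvNeg hG hEc hsel
  set A2 : Set (PropForm ℕ) := {ctx K (neg (var ((E W o a).c (W + 1))))} with hA2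
  have g3a : G.Yields (Γ ∪ A2) {ctx K (eqv ((T2 W o a).ge (W + 2) (W + 2)) ((T2 W o a).ge (W + 2) (W + 1)))} (K.size + 10) := by
    refine topEqv hG (T2 W o a) (av.t2.mono Set.subset_union_left) ?_ ?_
    · show ctx K (neg (var (Adder.extOut (E W o a) (W + 1) (W + 1)))) ∈ Γ ∪ A2
      rw [Adder.extOut_top]; exact Or.inr rfl
    · show ctx K (neg (var (Adder.extOut (XN W o a) (W + 1) (W + 1)))) ∈ Γ ∪ A2
      rw [Adder.extOut_top]; exact Or.inl hXNc
  have g3 := g3a.trans (negTransport hG (K := K) (x := (T2 W o a).ge (W + 2) (W + 1)) (y := (T2 W o a).ge (W + 2) (W + 2))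
    (Or.inl (Or.inl hT2)) (Or.inr rfl))
  set A3 := A2 ∪ ({ctx K (eqv ((T2 W o a).ge (W + 2) (W + 2)) ((T2 W o a).ge (W + 2) (W + 1)))} ∪
    {ctx K (neg (var ((T2 W o a).ge (W + 2) (W + 2))))}) with hA3
  let md : Sub.MonoData := ⟨(CDX W o a).base, (E W o a).base, (XN W o a).base, (T2 W o a).base, d W o,
    Adder.zext o.inp (fa a) W, Adder.zext (nv W o) (fa a) W, W + 1⟩
  have g4 : G.Yields (Γ ∪ A3) {ctx K (neg (var ((CDX W o a).ge (W + 1) (W + 1))))} ((W + 1 + 2) * (K.size + 55)) := by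
    have hΓΓ₃ : Γ ⊆ Γ ∪ A3 := Set.subset_union_left
    refine Yields.of_isBlock (Sub.MonoData.isBlock_monoRev hG.order md (av.cdx.mono hΓΓ₃) (av.e.mono hΓΓ₃) (av.xn.mono hΓΓ₃)
      (av.t2.mono hΓΓ₃) (Or.inr (Or.inr (Or.inr rfl)))) (fun θ hθ => ?_) (Sub.MonoData.proofSize_mono md K _)
    rw [Set.mem_singleton_iff.1 hθ]; exact List.mem_append_right _ (List.mem_singleton_self _)
  set A4 := A3 ∪ {ctx K (neg (var ((CDX W o a).ge (W + 1) (W + 1))))} with hA4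
  have g5 : G.Yields (Γ ∪ A4) ({ctx K (neg (var ((CDX W o a).x W)))} ∪ {ctx K (neg (var ((CDX W o a).ge (W + 1) W)))}) (2 * (K.size + 3)) := by
    refine Yields.of_isBlock (Sub.isBlock_topBit hG.order (CDX W o a) (av.cdx.mono Set.subset_union_left) ?_ (Or.inr (Or.inr rfl)))
      (fun θ hθ => ?_) ?_
    · show ctx K (neg (var (Adder.zext o.inp (fa a) W W))) ∈ Γ ∪ A4
      rw [Adder.zext_top]; exact Or.inl hfa
    · rcases hθ with hθ | hθ <;> rw [Set.mem_singleton_iff.1 hθ] <;> simp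
    · simp [proofSize, ctx, size]; omega
  have h := ((g2.trans g3).trans g4).trans g5
  refine (h.mono_right ?_).mono_size (by nlinarith)
  rintro θ (hθ | hθ)
  · exact Or.inl (Or.inl (Or.inl hθ))
  · exact Or.inr (Or.inl hθ)

end DomAux

/-! ### The two cases of the split identity -/

namespace SplitAux

open DomAux

variable {G : FregeSystem} {K : PropForm ℕ} {Γ : Set (PropForm ℕ)} {W : ℕ} {o a b : Occ}

/-- **Case `G`: `zext(u) = d` and the split adder is the adder `d + n = s`.**
[cite: CookReckhow1979, §2] [cite: Krajicek1995, §9.2] -/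
theorem caseSel (hG : RulesOK G) (v : Views W o K Γ) (av : AuxViews W o a K Γ) (sv : SplitViews W o b K Γ)
    (hsel : ctx K (var (sel W o)) ∈ Γ) (hEc : ctx K (biimp (var ((E W o a).c (W + 1))) (neg (var (sel W o)))) ∈ Γ)
    (hT2 : ctx K (neg (var ((T2 W o a).ge (W + 2) (W + 1)))) ∈ Γ) (hXNc : ctx K (neg (var ((XN W o a).c (W + 1)))) ∈ Γ)
    (hfa : ctx K (neg (var (fa a))) ∈ Γ) (hf : ctx K (neg (var (f W o))) ∈ Γ)
    (hsub : ∀ i < W + 1, ctx K (eqv ((E W o a).s i) ((S W o).x i)) ∈ Γ) :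
    G.Yields Γ (ctxSet K (splitBodies W o b)) ((7 * W + 25) * (K.size + 55)) := by
  -- s1: the top bit of `d` vanishes, `d + n` does not overflow
  have s1 := caseSelTop hG av hsel hEc hT2 hXNc hfa
  set A1 : Set (PropForm ℕ) := {ctx K (neg (var ((E W o a).c (W + 1))))} ∪ {ctx K (neg (var (d W o W)))} with hA1
  -- s2: the multiplexers select `d`
  have s2 : G.Yields (Γ ∪ A1) (ctxSet K (eqW (u W o) (d W o) W)) (W * (K.size + 10)) :=
    Yields.muxRelW_true hG.logic (w₂ := (A W o).s) (holds_muxRelW_iff.2 fun i hi => Or.inl (v.mux i hi)) (Or.inl hsel)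
  set A2 := A1 ∪ ctxSet K (eqW (u W o) (d W o) W) with hA2
  -- s3: the masks are the bits of `n`
  have s3 : G.Yields (Γ ∪ A2) (ctxSet K (eqW (M b) (nv W o) W)) (W * (K.size + 9 + 1)) :=
    Yields.ctx_range (fun i hi => Or.inr (Logic.infer hG.logic 15 (by decide) (FregeSystem.sub [K, var (M b i), var (sel W o), var (nv W o i)])
      rfl (FregeSystem.prems_cons (Or.inl (sv.mask i hi)) (FregeSystem.prems_cons (Or.inl hsel) FregeSystem.prems_nil))))
      fun _ _ => (size_eqv _ _).le
  set A3 := A2 ∪ ctxSet K (eqW (M b) (nv W o) W) with hA3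
  -- s4: `f ↔ d_W` and `f ↔ f'` (pairs of false bits)
  have s4 : G.Yields (Γ ∪ A3) ({ctx K (eqv (f W o) (d W o W))} ∪ {ctx K (eqv (f W o) (fa a))}) ((K.size + 10) + (K.size + 10)) := by
    refine Yields.union ?_ ?_
    · have h := Yields.single (Logic.infer hG.logic 10 (by decide) (S := Γ ∪ A3) (FregeSystem.sub [K, var (f W o), var (d W o W)])
        (θ := ctx K (eqv (f W o) (d W o W))) rfl
        (FregeSystem.prems_cons (Or.inl hf) (FregeSystem.prems_cons (Or.inr (Or.inl (Or.inl (Or.inr rfl)))) FregeSystem.prems_nil)))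
      exact h.mono_size (by simp [ctx, eqv, size, FregeSystem.size_biimp])
    · have h := Yields.single (Logic.infer hG.logic 10 (by decide) (S := Γ ∪ A3) (FregeSystem.sub [K, var (f W o), var (fa a)])
        (θ := ctx K (eqv (f W o) (fa a))) rfl
        (FregeSystem.prems_cons (Or.inl hf) (FregeSystem.prems_cons (Or.inl hfa) FregeSystem.prems_nil)))
      exact h.mono_size (by simp [ctx, eqv, size, FregeSystem.size_biimp])
  set A4 := A3 ∪ ({ctx K (eqv (f W o) (d W o W))} ∪ {ctx K (eqv (f W o) (fa a))}) with hA4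
  -- s5: the split adder and the adder `d + n` agree wire by wire
  have s5 : G.Yields (Γ ∪ A4) {χ | χ ∈ Adder.leibLines (P W o b) (E W o a) K (W + 1)} ((2 * (W + 1) + 1) * (K.size + 10)) := by
    refine Yields.of_isBlock (Adder.isBlock_leibLines hG.netlist (P W o b) (E W o a) (sv.adder.mono Set.subset_union_left)
      (av.e.mono Set.subset_union_left) (fun i hi => ?_) fun i hi => ?_) subset_rfl (Adder.proofSize_leibLines _ _ _ _)
    · show ctx K (eqv (Adder.zext (u W o) (f W o) W i) (d W o i)) ∈ Γ ∪ A4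
      rcases Nat.lt_succ_iff_lt_or_eq.1 hi with hi' | hi'
      · rw [Adder.zext_lt _ _ hi']; exact Or.inr (Or.inl (Or.inl (Or.inr (mem_ctxSet (mem_eqW hi')))))
      · rw [hi', Adder.zext_top]; exact Or.inr (Or.inr (Or.inl rfl))
    · show ctx K (eqv (Adder.zext (M b) (f W o) W i) (Adder.zext (nv W o) (fa a) W i)) ∈ Γ ∪ A4
      rcases Nat.lt_succ_iff_lt_or_eq.1 hi with hi' | hi'
      · rw [Adder.zext_lt _ _ hi', Adder.zext_lt _ _ hi']; exact Or.inr (Or.inl (Or.inr (mem_ctxSet (mem_eqW hi'))))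
      · rw [hi', Adder.zext_top, Adder.zext_top]; exact Or.inr (Or.inr (Or.inr rfl))
  set A5 := A4 ∪ {χ | χ ∈ Adder.leibLines (P W o b) (E W o a) K (W + 1)} with hA5
  -- s6: the sum bits of the split adder are the bits of `s`
  have s6 : G.Yields (Γ ∪ A5) (ctxSet K (eqW (P W o b).s (Adder.extOut (A W o) W) (W + 1))) ((W + 1) * (K.size + 10)) :=
    Yields.eqW_trans hG.logic (b := (E W o a).s) (holds_eqW_iff.2 fun i hi => Or.inr (Or.inr (Adder.mem_leibLines (by omega))))
      (holds_eqW_iff.2 fun i hi => Or.inl (hsub i hi))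
  set A6 := A5 ∪ ctxSet K (eqW (P W o b).s (Adder.extOut (A W o) W) (W + 1)) with hA6
  -- s7: no overflow of the split adder
  have s7 : G.Yields (Γ ∪ A6) {ctx K (neg (var ((P W o b).c (W + 1))))} (2 * (K.size + 10)) :=
    negTransport hG (Or.inr (Or.inl (Or.inl (Or.inl (Or.inl (Or.inl (Or.inl rfl)))))))
      (Or.inr (Or.inl (Or.inr (Adder.mem_leibLines (k := 2 * (W + 1)) (by omega)))))
  have h := (((((s1.trans s2).trans s3).trans s4).trans s5).trans s6).trans s7
  refine (h.mono_right ?_).mono_size (by nlinarith)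
  rintro θ ⟨L, hL, rfl⟩
  rcases List.mem_append.1 hL with hL | hL
  · exact Or.inl (Or.inr (mem_ctxSet hL))
  · rw [List.mem_singleton.1 hL]; exact Or.inr rfl

/-- **Case `¬G`: the mask vanishes, the split adder adds zero, and `zext(u) = s`.**
[cite: CookReckhow1979, §2] [cite: Krajicek1995, §9.2] -/
theorem caseNotSel (hG : RulesOK G) (v : Views W o K Γ) (sv : SplitViews W o b K Γ) (hnsel : ctx K (neg (var (sel W o))) ∈ Γ)
    (hf : ctx K (neg (var (f W o))) ∈ Γ) : G.Yields Γ (ctxSet K (splitBodies W o b)) ((6 * W + 12) * (K.size + 10)) := by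
  -- t1: the masks are false
  have t1 : G.Yields Γ (ctxSet K ((List.range W).map fun i => neg (var (M b i)))) (W * (K.size + 2 + 1)) :=
    Yields.ctx_range (fun i hi => Or.inr (Logic.infer hG.logic 16 (by decide) (FregeSystem.sub [K, var (M b i), var (sel W o), var (nv W o i)])
      rfl (FregeSystem.prems_cons (sv.mask i hi) (FregeSystem.prems_cons hnsel FregeSystem.prems_nil)))) fun _ _ => by simp [size]
  set A1 := ctxSet K ((List.range W).map fun i => neg (var (M b i))) with hA1
  -- t2: the split adder adds zero
  have t2 : G.Yields (Γ ∪ A1) {χ | χ ∈ Adder.zeroLines (P W o b) K (W + 1)} ((2 * (W + 1) + 1) * (K.size + 10)) := by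
    refine Yields.of_isBlock (Adder.isBlock_zeroLines hG.adderLaw (P W o b) (sv.adder.mono Set.subset_union_left) fun i hi => ?_)
      subset_rfl (Adder.proofSize_zeroLines _ _ _)
    show ctx K (neg (var (Adder.zext (M b) (f W o) W i))) ∈ Γ ∪ A1
    rcases Nat.lt_succ_iff_lt_or_eq.1 hi with hi' | hi'
    · rw [Adder.zext_lt _ _ hi']; exact Or.inr (mem_ctxSet (List.mem_map.2 ⟨i, List.mem_range.2 hi', rfl⟩))
    · rw [hi', Adder.zext_top]; exact Or.inl hf
  set A2 := A1 ∪ {χ | χ ∈ Adder.zeroLines (P W o b) K (W + 1)} with hA2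
  -- t3: the top bit of `s` vanishes
  have t3 : G.Yields (Γ ∪ A2) ({ctx K (neg (var ((S W o).x W)))} ∪ {ctx K (neg (var ((S W o).ge (W + 1) W)))}) (2 * (K.size + 3)) := by
    refine Yields.of_isBlock (Sub.isBlock_topBit hG.order (S W o) (v.cmp.mono Set.subset_union_left) ?_ (Or.inl hnsel)) (fun θ hθ => ?_) ?_
    · show ctx K (neg (var (Adder.zext (nv W o) (f W o) W W))) ∈ Γ ∪ A2
      rw [Adder.zext_top]; exact Or.inl hf
    · rcases hθ with hθ | hθ <;> rw [Set.mem_singleton_iff.1 hθ] <;> simp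
    · simp [proofSize, ctx, size]; omega
  set A3 := A2 ∪ ({ctx K (neg (var ((S W o).x W)))} ∪ {ctx K (neg (var ((S W o).ge (W + 1) W)))}) with hA3
  -- t4: the multiplexers select `s`
  have t4 : G.Yields (Γ ∪ A3) (ctxSet K (eqW (u W o) (A W o).s W)) (W * (K.size + 10)) :=
    Yields.muxRelW_false hG.logic (w₁ := d W o) (holds_muxRelW_iff.2 fun i hi => Or.inl (v.mux i hi)) (Or.inl hnsel)
  set A4 := A3 ∪ ctxSet K (eqW (u W o) (A W o).s W) with hA4
  -- t5: `f ↔ c_W(s)` (both false)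
  have t5 : G.Yields (Γ ∪ A4) {ctx K (eqv (f W o) ((A W o).c W))} (K.size + 10) := by
    have hc : ctx K (neg (var ((A W o).c W))) ∈ Γ ∪ A4 := by
      refine Or.inr (Or.inl (Or.inr (Or.inl ?_)))
      rw [Set.mem_singleton_iff]
      show _ = ctx K (neg (var (Adder.extOut (A W o) W W)))
      rw [Adder.extOut_top]
    have h := Yields.single (Logic.infer hG.logic 10 (by decide) (S := Γ ∪ A4) (FregeSystem.sub [K, var (f W o), var ((A W o).c W)])
      (θ := ctx K (eqv (f W o) ((A W o).c W))) rfl (FregeSystem.prems_cons (Or.inl hf) (FregeSystem.prems_cons hc FregeSystem.prems_nil)))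
    exact h.mono_size (by simp [ctx, eqv, size, FregeSystem.size_biimp])
  set A5 := A4 ∪ {ctx K (eqv (f W o) ((A W o).c W))} with hA5
  -- t6: the sum bits of the split adder are the bits of `s`
  have t6 : G.Yields (Γ ∪ A5) (ctxSet K (eqW (P W o b).s (Adder.extOut (A W o) W) (W + 1))) ((W + 1) * (K.size + 10)) := by
    refine Yields.eqW_trans hG.logic (b := (P W o b).x) (holds_eqW_iff.2 fun i hi => Or.inr (Or.inl (Or.inl (Or.inl (Or.inr (Adder.sum_mem_zeroLines hi))))))
      (holds_eqW_iff.2 fun i hi => ?_)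
    show ctx K (eqv (Adder.zext (u W o) (f W o) W i) (Adder.extOut (A W o) W i)) ∈ Γ ∪ A5
    rcases Nat.lt_succ_iff_lt_or_eq.1 hi with hi' | hi'
    · rw [Adder.zext_lt _ _ hi', Adder.extOut_lt _ hi']; exact Or.inr (Or.inl (Or.inr (mem_ctxSet (mem_eqW hi'))))
    · rw [hi', Adder.zext_top, Adder.extOut_top]; exact Or.inr (Or.inr rfl)
  have h := ((((t1.trans t2).trans t3).trans t4).trans t5).trans t6
  refine (h.mono_right ?_).mono_size (by nlinarith)
  rintro θ ⟨L, hL, rfl⟩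
  rcases List.mem_append.1 hL with hL | hL
  · exact Or.inr (mem_ctxSet hL)
  · rw [List.mem_singleton.1 hL]
    exact Or.inl (Or.inl (Or.inl (Or.inl (Or.inr (Adder.carry_mem_zeroLines le_rfl)))))

/-! ### The split identity -/

/-- The facts carried into the case `G`. [folklore] -/
def caseFacts (W : ℕ) (o a : Occ) : List (PropForm ℕ) :=
  [biimp (var ((E W o a).c (W + 1))) (neg (var (sel W o))), neg (var ((T2 W o a).ge (W + 2) (W + 1))),
    neg (var ((XN W o a).c (W + 1))), neg (var (fa a)), neg (var (f W o))] ++ eqW (E W o a).s (S W o).x (W + 1)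

/-- Sizes of the carried facts. [folklore] -/
theorem size_of_mem_caseFacts {L : PropForm ℕ} (h : L ∈ caseFacts W o a) : L.size ≤ 11 := by
  rcases List.mem_append.1 h with h | h
  · simp only [List.mem_cons, List.not_mem_nil, or_false] at h
    rcases h with h | h | h | h | h <;> subst h <;> simp [FregeSystem.size_biimp, size]
  · obtain ⟨i, -, rfl⟩ := List.mem_map.1 h
    simp [size_eqv]

/-- Length of the carried facts. [folklore] -/
@[simp] theorem length_caseFacts : (caseFacts W o a).length = W + 6 := by simp [caseFacts, eqW]

/-- **The split identity inside Frege**: for an available occurrence of `x ⊕ₙ y` with `y < n`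
certified (no certificate for `x` is needed), and available correctly wired occurrences of the domain-closure and split
auxiliary templates, the split adder `P = zext(u) + zext(G ∧ n)` provably has the sum bits of
`s = x + y` and no carry: `s = u + G·n`. Polynomial size: `≤ (90W + 200)(|K| + 63)`.
[cite: CookReckhow1979, §2] [cite: Krajicek1995, §9.2] -/
theorem splitSum (hG : RulesOK G) (ho : o.Avail (addModT W) (3 * W) K Γ) (haa : a.Avail (domAuxT W) (4 * W + 1) K Γ)
    (hw : Wired W o a) (hb : b.Avail (splitAuxT W) (2 * W + 2) K Γ) (hwb : SWired W o b)
    (hy : LtN W K Γ (fun i => o.inp (W + i)) (nv W o)) :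
    G.Yields Γ (ctxSet K (splitBodies W o b)) ((90 * W + 200) * (K.size + 63)) := by
  have v := avail ho
  have av := auxAvail haa hw
  have sv := splitAvail hb hwb
  have hΓ : ∀ {X : Set (PropForm ℕ)}, Γ ⊆ Γ ∪ X := fun {X} => Set.subset_union_left
  -- the case-free preparations (as for domain closure)
  have p1 := eqBot hG v av
  set A1 : Set (PropForm ℕ) := {ctx K (eqv (fa a) (f W o))} with hA1
  have p2 := subAdd hG (v.mono hΓ) (av.mono hΓ) (Or.inr rfl : ctx K (eqv (fa a) (f W o)) ∈ Γ ∪ A1)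
  set A2 := A1 ∪ {χ | χ ∈ Sub.subAddLines (S W o) (E W o a) K (W + 1)} with hA2
  have p3 := commAYX hG (v.mono (hΓ (X := A2))) (av.mono hΓ)
  set A3 := A2 ∪ {χ | χ ∈ Adder.commLines (A W o) (YX W o a) K W} with hA3
  have p4 := mono1 hG (av.mono (hΓ (X := A3))) (hy.mono hΓ)
  set A4 := A3 ∪ {ctx K (neg (var ((T1 W o a).ge (W + 1) (W + 1))))} with hA4
  have p5 := commNX hG (av.mono (hΓ (X := A4)))
  set A5 := A4 ∪ ctxSet K (eqW (NX W o a).wire (XN W o a).wire (2 * W + 1)) with hA5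
  have p6 := topXN hG (av.mono (hΓ (X := A5)))
  set A6 := A5 ∪ ({ctx K (eqv ((XN W o a).s W) ((XN W o a).c W))} ∪ {ctx K (neg (var ((XN W o a).c (W + 1))))}) with hA6
  have p7 := linkT2 hG (av.mono (hΓ (X := A6))) (fun θ hθ => Or.inr (Or.inl (Or.inl (Or.inl (Or.inl (Or.inr hθ))))))
    (fun θ hθ => Or.inr (Or.inl (Or.inl (Or.inl (Or.inr hθ))))) (Or.inr (Or.inl (Or.inl (Or.inr rfl))))
    (fun θ hθ => Or.inr (Or.inl (Or.inr hθ))) (Or.inr (Or.inr (Or.inl rfl)))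
  set A7 := A6 ∪ {ctx K (neg (var ((T2 W o a).ge (W + 2) (W + 1))))} with hA7
  have p8 := (Yields.lit_of_cstDef hG.logic (hΓ (X := A7) v.bot)).union (Yields.lit_of_cstDef hG.logic (hΓ av.bot))
  set A8 := A7 ∪ ({ctx K (lit (f W o) false)} ∪ {ctx K (lit (fa a) false)}) with hA8
  have pAll := ((((((p1.trans p2).trans p3).trans p4).trans p5).trans p6).trans p7).trans p8
  -- memberships of the carried facts in `Γ ∪ A8`
  have mEc : ctx K (biimp (var ((E W o a).c (W + 1))) (neg (var (sel W o)))) ∈ Γ ∪ A8 :=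
    Or.inr (Or.inl (Or.inl (Or.inl (Or.inl (Or.inl (Or.inl (Or.inr
      (Sub.carry_mem_subAddLines (S := S W o) (E := E W o a) (K := K) (w := W + 1) le_rfl))))))))
  have mSub : ∀ i < W + 1, ctx K (eqv ((E W o a).s i) ((S W o).x i)) ∈ Γ ∪ A8 := fun i hi =>
    Or.inr (Or.inl (Or.inl (Or.inl (Or.inl (Or.inl (Or.inl (Or.inr
      (Sub.sum_mem_subAddLines (S := S W o) (E := E W o a) (K := K) hi))))))))
  have mT2 : ctx K (neg (var ((T2 W o a).ge (W + 2) (W + 1)))) ∈ Γ ∪ A8 := Or.inr (Or.inl (Or.inr rfl))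
  have mXN : ctx K (neg (var ((XN W o a).c (W + 1)))) ∈ Γ ∪ A8 := Or.inr (Or.inl (Or.inl (Or.inr (Or.inr rfl))))
  have mfa : ctx K (neg (var (fa a))) ∈ Γ ∪ A8 := Or.inr (Or.inr (Or.inr rfl))
  have mf : ctx K (neg (var (f W o))) ∈ Γ ∪ A8 := Or.inr (Or.inr (Or.inl rfl))
  have hoD : (o.inst (3 * W)).DefsAvail (addModT W) K (Γ ∪ A8) := Inst.DefsAvail.mono ho hΓ
  have haD : (a.inst (4 * W + 1)).DefsAvail (domAuxT W) K (Γ ∪ A8) := Inst.DefsAvail.mono haa hΓ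
  have hbD : (b.inst (2 * W + 2)).DefsAvail (splitAuxT W) K (Γ ∪ A8) := Inst.DefsAvail.mono hb hΓ
  -- case `G`: context `K ∨ ¬G`
  have hsel : Holds K (Γ ∪ A8) (caseFacts W o a) := by
    intro L hL
    rcases List.mem_append.1 hL with hL | hL
    · simp only [List.mem_cons, List.not_mem_nil, or_false] at hL
      rcases hL with rfl | rfl | rfl | rfl | rfl
      exacts [mEc, mT2, mXN, mfa, mf]
    · obtain ⟨i, hi, rfl⟩ := List.mem_map.1 hL
      exact mSub i (List.mem_range.1 hi)
  have b₁ : G.Yields (Γ ∪ A8) (ctxSet (selCtx W K o) (splitBodies W o b))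
      ((9 * W + 7) * (K.size + 2 + 59) + (23 * W + 32) * (K.size + 2 + 59) + (3 * W + 3) * (K.size + 2 + 59) +
        (W + 6) * (K.size + 2 + 11 + 2) + (K.size + 2 * 1 + 3) + (7 * W + 25) * (K.size + 3 + 55)) := by
    have w1 : G.Yields (Γ ∪ A8) (ctxSet (selCtx W K o) ((o.inst (3 * W)).defBodies (addModT W))) ((9 * W + 7) * (K.size + 2 + 59)) := by
      have h := hoD.weaken hG.logic (neg (var (sel W o))); rw [length_addModT] at h; exact h
    have w2 : G.Yields (Γ ∪ A8) (ctxSet (selCtx W K o) ((a.inst (4 * W + 1)).defBodies (domAuxT W))) ((23 * W + 32) * (K.size + 2 + 59)) := by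
      have h := haD.weaken hG.logic (neg (var (sel W o))); rw [length_domAuxT] at h; exact h
    have w2b : G.Yields (Γ ∪ A8) (ctxSet (selCtx W K o) ((b.inst (2 * W + 2)).defBodies (splitAuxT W))) ((3 * W + 3) * (K.size + 2 + 59)) := by
      have h := hbD.weaken hG.logic (neg (var (sel W o))); rw [length_splitAuxT] at h; exact h
    have w3 : G.Yields (Γ ∪ A8) (ctxSet (selCtx W K o) (caseFacts W o a)) ((W + 6) * (K.size + 2 + 11 + 2)) := by
      have h := Yields.weaken hG.logic hsel (neg (var (sel W o))) fun L hL => size_of_mem_caseFacts hL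
      rw [length_caseFacts] at h; exact h
    have w4 : G.Yields (Γ ∪ A8) {ctx (selCtx W K o) (var (sel W o))} (K.size + 2 * 1 + 3) :=
      Yields.caseHypT hG.logic K (var (sel W o))
    have w := (((w1.union w2).union w2b).union w3).union w4
    set B : Set (PropForm ℕ) := (((ctxSet (selCtx W K o) ((o.inst (3 * W)).defBodies (addModT W)) ∪
      ctxSet (selCtx W K o) ((a.inst (4 * W + 1)).defBodies (domAuxT W))) ∪
      ctxSet (selCtx W K o) ((b.inst (2 * W + 2)).defBodies (splitAuxT W))) ∪ ctxSet (selCtx W K o) (caseFacts W o a)) ∪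
      {ctx (selCtx W K o) (var (sel W o))} with hB
    have hoD₁ : o.Avail (addModT W) (3 * W) (selCtx W K o) (Γ ∪ A8 ∪ B) :=
      Inst.defsAvail_of_ctxSet_subset fun θ hθ => Or.inr (Or.inl (Or.inl (Or.inl (Or.inl hθ))))
    have haD₁ : a.Avail (domAuxT W) (4 * W + 1) (selCtx W K o) (Γ ∪ A8 ∪ B) :=
      Inst.defsAvail_of_ctxSet_subset fun θ hθ => Or.inr (Or.inl (Or.inl (Or.inl (Or.inr hθ))))
    have hbD₁ : b.Avail (splitAuxT W) (2 * W + 2) (selCtx W K o) (Γ ∪ A8 ∪ B) :=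
      Inst.defsAvail_of_ctxSet_subset fun θ hθ => Or.inr (Or.inl (Or.inl (Or.inr hθ)))
    have v₁ : Views W o (selCtx W K o) (Γ ∪ A8 ∪ B) := avail hoD₁
    have av₁ : AuxViews W o a (selCtx W K o) (Γ ∪ A8 ∪ B) := auxAvail haD₁ hw
    have sv₁ : SplitViews W o b (selCtx W K o) (Γ ∪ A8 ∪ B) := splitAvail hbD₁ hwb
    have hF : ∀ L ∈ caseFacts W o a, ctx (selCtx W K o) L ∈ Γ ∪ A8 ∪ B := fun L hL => Or.inr (Or.inl (Or.inr (mem_ctxSet hL)))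
    have m1 : biimp (var ((E W o a).c (W + 1))) (neg (var (sel W o))) ∈ caseFacts W o a := List.mem_append_left _ (by simp)
    have m2 : neg (var ((T2 W o a).ge (W + 2) (W + 1))) ∈ caseFacts W o a := List.mem_append_left _ (by simp)
    have m3 : neg (var ((XN W o a).c (W + 1))) ∈ caseFacts W o a := List.mem_append_left _ (by simp)
    have m4 : neg (var (fa a)) ∈ caseFacts W o a := List.mem_append_left _ (by simp)
    have m5 : neg (var (f W o)) ∈ caseFacts W o a := List.mem_append_left _ (by simp)
    have c := caseSel hG v₁ av₁ sv₁ (Or.inr (Or.inr rfl)) (hF _ m1) (hF _ m2) (hF _ m3) (hF _ m4) (hF _ m5)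
      fun i hi => hF _ (List.mem_append_right _ (mem_eqW (a := (E W o a).s) hi))
    rw [size_selCtx] at c
    exact (w.trans c).mono_right Set.subset_union_right
  -- case `¬G`: context `K ∨ G`
  have b₂ : G.Yields (Γ ∪ A8) (ctxSet (notSelCtx W K o) (splitBodies W o b))
      ((9 * W + 7) * (K.size + 1 + 59) + (3 * W + 3) * (K.size + 1 + 59) + 1 * (K.size + 1 + 2 + 2) + (K.size + 2 * 1 + 3) +
        (6 * W + 12) * (K.size + 2 + 10)) := by
    have w1 : G.Yields (Γ ∪ A8) (ctxSet (notSelCtx W K o) ((o.inst (3 * W)).defBodies (addModT W))) ((9 * W + 7) * (K.size + 1 + 59)) := by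
      have h := hoD.weaken hG.logic (var (sel W o)); rw [length_addModT] at h; exact h
    have w2b : G.Yields (Γ ∪ A8) (ctxSet (notSelCtx W K o) ((b.inst (2 * W + 2)).defBodies (splitAuxT W))) ((3 * W + 3) * (K.size + 1 + 59)) := by
      have h := hbD.weaken hG.logic (var (sel W o)); rw [length_splitAuxT] at h; exact h
    have w3 : G.Yields (Γ ∪ A8) (ctxSet (notSelCtx W K o) [neg (var (f W o))]) (1 * (K.size + 1 + 2 + 2)) := by
      have h := Yields.weaken hG.logic (Ls := [neg (var (f W o))]) (fun L hL => by rw [List.mem_singleton.1 hL]; exact mf)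
        (var (sel W o)) (c := 2) fun L hL => by rw [List.mem_singleton.1 hL]; simp [size]
      exact h
    have w4 : G.Yields (Γ ∪ A8) {ctx (notSelCtx W K o) (neg (var (sel W o)))} (K.size + 2 * 1 + 3) :=
      Yields.caseHypF hG.logic K (var (sel W o))
    have w := ((w1.union w2b).union w3).union w4
    set B : Set (PropForm ℕ) := ((ctxSet (notSelCtx W K o) ((o.inst (3 * W)).defBodies (addModT W)) ∪
      ctxSet (notSelCtx W K o) ((b.inst (2 * W + 2)).defBodies (splitAuxT W))) ∪ ctxSet (notSelCtx W K o) [neg (var (f W o))]) ∪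
      {ctx (notSelCtx W K o) (neg (var (sel W o)))} with hB
    have hoD₂ : o.Avail (addModT W) (3 * W) (notSelCtx W K o) (Γ ∪ A8 ∪ B) :=
      Inst.defsAvail_of_ctxSet_subset fun θ hθ => Or.inr (Or.inl (Or.inl (Or.inl hθ)))
    have hbD₂ : b.Avail (splitAuxT W) (2 * W + 2) (notSelCtx W K o) (Γ ∪ A8 ∪ B) :=
      Inst.defsAvail_of_ctxSet_subset fun θ hθ => Or.inr (Or.inl (Or.inl (Or.inr hθ)))
    have v₂ : Views W o (notSelCtx W K o) (Γ ∪ A8 ∪ B) := avail hoD₂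
    have sv₂ : SplitViews W o b (notSelCtx W K o) (Γ ∪ A8 ∪ B) := splitAvail hbD₂ hwb
    have c := caseNotSel hG v₂ sv₂ (Or.inr (Or.inr rfl)) (Or.inr (Or.inl (Or.inr (mem_ctxSet (List.mem_singleton_self _)))))
    rw [size_notSelCtx] at c
    exact (w.trans c).mono_right Set.subset_union_right
  -- merging the cases
  have hcases := Yields.cases hG.logic (K := K) (A := var (sel W o)) (Ls := splitBodies W o b) (c := 9) b₁ b₂
    fun L hL => size_of_mem_splitBodies hL
  have h := pAll.trans (hcases : G.Yields (Γ ∪ A8) (ctxSet K (splitBodies W o b)) _)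
  refine (h.mono_right Set.subset_union_right).mono_size ?_
  simp only [length_splitBodies]
  nlinarith [Nat.zero_le W, Nat.zero_le K.size]

end SplitAux

end ModAdd

end Literature.Computability.MetaComplexity
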